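import Mathlib
import Summits.Ventures.PercRepro.TriangleCapBandThree

/-!
# PercRepro — THE COMPLETE BAND ON `5 + (s − t)` VERTICES, EVERY `t ≥ 6` (p3, gen 53; part 271)

With four non-neighbours the depth `u₁ = ⌊(t + 1)/4⌋` discharges every hypothesis of part 269's `band_complete`:
the structure hypothesis `4 (u₁ − 1) + 3 ≤ t` is `4 u₁ ≤ t + 1`, and the overlap of the sub-bands `u₁` and `u₁ + 1`
holds by `overlap_of_three_le` at `t = 6` (`u₁ = 1`), by the explicit width `twoW 4 2 = 8` for `7 ≤ t ≤ 10`
(`u₁ = 2`: `6 (t − 4) ≤ 4 (t − 3) + 10`), and by the quadratic width (`overlap_of_sq`) for `t ≥ 11` (`u₁ ≥ 3`,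
`3 t ≤ 12 u₁ + 6 ≤ u₁² + 8 u₁ + 9`).  **THE COMPLETE BAND ON `5 + (s − t)` VERTICES** (`band_four_complete`, `6 ≤ t`,
`2 t ≤ s`): `2 j` is attained IFF `j < B(u₁)` and `j` lies in a sub-band interval `u < u₁` (`q = max 1 ⌊u/3⌋`), or
`B(u₁) ≤ j` and `2 j + 2 ⌊t/4⌋ t ≤ t (t − 1) + 4 ⌊t/4⌋ (⌊t/4⌋ + 1)` — the census of part 252 at `ℓ = 4`
(`6 ≤ t ≤ 22`) verbatim.  Axioms: standard.
-/

namespace PercRepro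

namespace TriangleCap

namespace C047

open Finset

/-- The width of the sub-band `2` with four non-neighbours: `twoW 4 2 = 8` (`C(2,2) + 3 = 4`). -/
theorem twoW_four_two : twoW 4 2 = 8 := by
  unfold twoW
  rw [coll_lfRR_zero 3 2 (by norm_num)]

/-- **THE OVERLAP AT `ℓ = 4`, `u₁ = ⌊(t + 1)/4⌋`, EVERY `t ≥ 6`.** -/
theorem overlap_four (t : ℕ) (ht : 6 ≤ t) :
    2 * (((t + 1) / 4 + 1) * (t - (t + 1) / 4 - 2)) ≤
      2 * (((t + 1) / 4) * (t - (t + 1) / 4 - 1)) + twoW 4 ((t + 1) / 4) + 2 := by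
  rcases Nat.lt_or_ge t 7 with h6 | h7
  · -- `t = 6`, `u₁ = 1`
    have e : (t + 1) / 4 = 1 := by omega
    rw [e]
    exact overlap_of_three_le 4 t 1 (by omega)
  · rcases Nat.lt_or_ge t 11 with h10 | h11
    · -- `7 ≤ t ≤ 10`, `u₁ = 2`: `6 (t − 4) ≤ 4 (t − 3) + 10`
      have e : (t + 1) / 4 = 2 := by omega
      rw [e, twoW_four_two]
      have e1 : t - 2 - 2 = t - 4 := by omega
      have e2 : t - 2 - 1 = t - 3 := by omega
      rw [e1, e2]
      omega
    · -- `t ≥ 11`, `u₁ ≥ 3`: the quadratic width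
      apply overlap_of_sq 4 t ((t + 1) / 4) (by norm_num)
      have hu3 : 3 ≤ (t + 1) / 4 := by omega
      have hu4 : t ≤ 4 * ((t + 1) / 4) + 2 := by omega
      obtain ⟨u, hu⟩ : ∃ u, (t + 1) / 4 = u := ⟨_, rfl⟩
      rw [hu] at hu3 hu4 ⊢
      have e1 : (4 : ℕ) - 1 = 3 := by norm_num
      have e2 : (4 : ℕ) - 2 = 2 := by norm_num
      rw [e1, e2]
      have hsub : t - 2 * u - 2 ≤ 2 * u := by omega
      calc 2 * (3 * (t - 2 * u - 2)) ≤ 2 * (3 * (2 * u)) := by gcongr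
        _ ≤ 2 * (u * (u + 1)) + 2 * u + 2 * 3 := by nlinarith

/-- **THE COMPLETE BAND ON `5 + (s − t)` VERTICES** (four non-neighbours of the vertex of degree `s − t`; `6 ≤ t`,
`2 t ≤ s`), with `u₁ = ⌊(t + 1)/4⌋`: the band value `2 j` is attained IFF either `j < u₁ (t − u₁ − 1)` and `j` lies in
a sub-band interval `u < u₁` (`u (t − u − 1) ≤ j` and `2 j + 2 q u ≤ 2 u (t − u − 1) + u (u + 1) + 3 q (q + 1)` at
`q = subQ 4 u = max 1 ⌊u/3⌋`), or `u₁ (t − u₁ − 1) ≤ j` and `2 j + 2 ⌊t/4⌋ t ≤ t (t − 1) + 4 ⌊t/4⌋ (⌊t/4⌋ + 1)`. -/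
theorem band_four_complete (s t j : ℕ) (ht : 6 ≤ t) (hs : 2 * t ≤ s) :
    (∃ (H : SimpleGraph (Fin (4 + 1 + (s - t)))) (_ : DecidableRel H.Adj), H.CliqueFree 3 ∧
      H.edgeFinset.card = s ∧ (∃ w, deg H w + t = s) ∧
      ∑ v, deg H v * deg H v + 2 * (t * (s - t - 1)) + 2 * j = s * (s + 1)) ↔
    ((j < ((t + 1) / 4) * (t - (t + 1) / 4 - 1) ∧ ∃ u, u + 1 ≤ (t + 1) / 4 ∧ u * (t - u - 1) ≤ j ∧
        2 * j + 2 * (subQ 4 u * u) ≤ 2 * (u * (t - u - 1)) + u * (u + 1) + (4 - 1) * (subQ 4 u * (subQ 4 u + 1))) ∨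
      (((t + 1) / 4) * (t - (t + 1) / 4 - 1) ≤ j ∧
        2 * j + 2 * (t / 4) * t ≤ t * (t - 1) + 4 * ((t / 4) * (t / 4 + 1)))) := by
  apply band_complete 4 s t ((t + 1) / 4) j (by norm_num) (by omega) hs (by omega) (by omega) (by omega) (by omega)
  · exact overlap_four t ht
  · left
    omega

end C047

end TriangleCap

end PercRepro
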